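import Summits.BirchSwinnertonDyer.BirchSwinnertonDyer.Theorems.ResidualThetaTransportAtTwoRlfTwistedUniformExponent
import HarnessLib

/-!
# Road T for item 23110, brick (D5) — FINAL binder form: the `±`-duality hypothesis for ALTERNATING NON-DEGENERATE Weil data only

Route `ResidualThetaTransportAtTwo` (RTT, crux r201 `ResidualLambdaFormulaNegDiscAtTwo`, stmt-BirchSwinnertonDyer-23110) /
`ThetaPartnerAtTwo` (TP2). Seat `prover-bsd-wall-tp2-p2x` g12 LEAD (`--supports stmt-BirchSwinnertonDyer-23110`). THEOREMS ONLY (no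
definition, no named fact, no `sorry`); closes nothing by itself. Sequel of `…RlfTwistedUniformExponent` (p660516).

In `uniformExponent_of_plusDual_of_eigen` / `hlevEventual_two_of_plusDual_of_eigen` the `±`-duality binder `hdual` quantifies over every
biadditive Galois-equivariant `μ_{p^J}`-valued pairing `e` on `E[p^J]`, including the degenerate `e ≡ 1`, for which the Weil dual map
`twistedWeilDual … e` vanishes and the hypothesis of `hdual` is vacuous — so `hdual` as typed there would assert
`twistedTorsionLocalKummer(u') = ⊤`, which is false (w2 g15, 2026-08-28). Here the binder carries the non-degeneracy
`hnondeg : ∀ T, (∀ S, e S T = 1) → T = 0` (the 5th component of `WeierstrassCurve.exists_weilPairing_holds`), under which the Weil dual map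
is a bijection (`twistedWeilDual_bijective`) AND the alternating property `halt : ∀ T, e T T = 1` (w2 g15, 19:53Z: the `±`-isotropy rests
on the Kummer isotropy, which needs `e` to be a power of the Weil pairing); the proofs are otherwise verbatim (the Weil data of
`exists_weilPairing_holds` has both).

* `uniformExponent_of_plusDualAlt_of_eigen`, **`hlevEventual_two_of_plusDualAlt_of_eigen`** — the statements H-PLUSDUAL (`hdual`, Kim 2007
  Prop. 3.18 read at `2`, twisted, level `ℚ`) and H-FIN (`hfinE`) are the two remaining named inputs of `hlev_eventual(u)` at `ℚ`, `p = 2`.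

HONEST FRAMING: closes nothing; `hdual` and `hfinE` are NOT proved here; 23110 is NOT proved; BSD is not proved by any of this.
References: [GreenbergLNM1716] §4 pp. 122–124; [Kobayashi2003] Def. 1.1; B. D. Kim, Compositio Math. 143 (2007), Props. 3.15–3.18.
-/

-- the Theorems namespace of this sub repeats the summit name by design (D-0017 nested layout)
set_option linter.dupNamespace false

noncomputable section

open scoped Classical NumberField

open NumberField IsDedekindDomain Field
open Literature.NumberTheory.EllipticCurves Literature.NumberTheory.GaloisRepresentations
  Literature.NumberTheory.GaloisCohomology WeierstrassCurve ZpExtension Literature.NumberTheory.EllipticCurves.Kobayashi2003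
  Literature.NumberTheory.EllipticCurves.GreenbergVatsal2000
open Literature.NumberTheory.GaloisRepresentations.DiscreteGaloisModule (localTatePairingZMod unramifiedSubgroup
  SelmerStructure TateDual tateDual)

namespace Summit.BirchSwinnertonDyer.BirchSwinnertonDyer.Theorems.SignedEC.TwistedPT

variable {K : Type} [Field K] [NumberField K] (W : WeierstrassCurve K) [W.IsElliptic] (p : ℕ) [Fact p.Prime]
  (S₀ : Finset (HeightOneSpectrum (𝓞 K))) (κ : ZpExtension K p) {γ : Field.absoluteGaloisGroup K} (u : ℤ) (hu : (p : ℤ) ∣ u - 1)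
  (A : ∀ v : HeightOneSpectrum (𝓞 K), AddSubgroup (localPoints W (v.adicCompletion K)))

/-- **Uniform exponent of the dual signed Selmer groups — `±`-duality for NON-DEGENERATE Weil data** (repaired form of
`uniformExponent_of_plusDual_of_eigen`: `hdual` carries `hnondeg`). [cite: GreenbergLNM1716, §4 pp. 122–124] [cite: Kobayashi2003, Def. 1.1] -/
theorem uniformExponent_of_plusDualAlt_of_eigen (hγ : κ.IsTopGenerator γ) [hfin : ∀ J : ℕ, Finite (W.geomTorsion ((p ^ J : ℕ) : ℤ))]
    (hS₀ : ∀ v ∈ S₀, ((p : ℕ) : 𝓞 K) ∉ v.asIdeal)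
    (hS : ∀ (J : ℕ) (v : HeightOneSpectrum (𝓞 K)), (Sum.inr v : Place K) ∉ twistedDescentPlaces (K := K) p S₀ →
      ((p ^ J : ℕ) : 𝓞 K) ∉ v.asIdeal ∧ GaloisRep.IsUnramifiedAt v (W.twistedTorsionGaloisModule p κ J u hu))
    (hfix : ∀ P : W.geomPrimaryTorsion p, (∀ h : κ.kerSubgroup, h • P = P) → P = 0)
    (hdual : ∀ (J : ℕ) (u' : ℤ) (hu' : (p : ℤ) ∣ u' - 1) (huu' : ((p : ℤ) ^ J) ∣ u * u' - 1)
      (e : W.geomTorsion ((p ^ J : ℕ) : ℤ) → W.geomTorsion ((p ^ J : ℕ) : ℤ) → AlgebraicClosure K)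
      (hμ : ∀ S T, e S T ^ (p ^ J) = 1) (hadd₁ : ∀ S₁ S₂ T, e (S₁ + S₂) T = e S₁ T * e S₂ T)
      (hadd₂ : ∀ S T₁ T₂, e S (T₁ + T₂) = e S T₁ * e S T₂)
      (hgal : ∀ (σ : absoluteGaloisGroup K) (S T : W.geomTorsion ((p ^ J : ℕ) : ℤ)), σ • e S T = e (σ • S) (σ • T))
      (halt : ∀ T, e T T = 1) (hnondeg : ∀ T, (∀ S, e S T = 1) → T = 0)
      (inv : LocalInvariants K (p ^ J)), inv.IsPerfect → inv.SumLocalTermEqZero → inv.UnramifiedOrthogonal →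
      ∀ (v : HeightOneSpectrum (𝓞 K)), ((p : ℕ) : 𝓞 K) ∈ v.asIdeal →
      ∀ y' : galoisCohomology ((W.twistedTorsionGaloisModule p κ J u' hu').restrictField (v.adicCompletion K)) 1,
        galoisCohomology.map ((W.twistedWeilDual p κ J hu hu' huu' e hμ hadd₁ hadd₂ hgal).restrictField (v.adicCompletion K)) 1 y' ∈
            inv.dualLocalCondition (W.twistedTorsionGaloisModule p κ J u hu) (Sum.inr v)
              (W.twistedTorsionLocalKummer p κ J u hu (v.adicCompletion K) (A v)) →
        y' ∈ W.twistedTorsionLocalKummer p κ J u' hu' (v.adicCompletion K) (A v))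
    (hfinE : ∃ e : ℕ, ∀ c ∈ unramifiedOutside κ.kerSubgroup ↥(W.geomPrimaryTorsion p) p (↑S₀ : Set (HeightOneSpectrum (𝓞 K))) ⊓
        ⨅ (v : HeightOneSpectrum (𝓞 K)) (_ : ((p : ℕ) : 𝓞 K) ∈ v.asIdeal) (σ : Field.absoluteGaloisGroup K),
          (localKummerOverOfEmb W p κ.kerSubgroup (closureEmb (K := K) (v.adicCompletion K)) (A v)).comap
            (W.conjH1 p κ.kerSubgroup σ),
      W.conjH1 p κ.kerSubgroup γ c = u • c → p ^ e • c = 0) :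
    ∃ e : ℕ, ∀ (J : ℕ) (inv : LocalInvariants K (p ^ J)), inv.IsPerfect → inv.SumLocalTermEqZero → inv.UnramifiedOrthogonal →
      ∀ y ∈ (inv.dualSelmerStructure (W.twistedTorsionGaloisModule p κ J u hu)
          (W.twistedSignedSelmerStructure p S₀ κ J u hu A)).selmerGroup, p ^ e • y = 0 := by
  obtain ⟨e, he⟩ := hfinE
  refine ⟨e, fun J inv hperf hvan hur y hy ↦ ?_⟩
  haveI : CharZero K := inferInstance
  -- `p^J` kills every class of `H¹(K, E[p^J](χ_u)^D)`
  have hkill : p ^ J • y = 0 :=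
    nsmul_continuousCohomology_one_eq_zero _ (p ^ J)
      (fun f ↦ ZpExtension.pow_nsmul_tateDual_eq_zero (W.pow_nsmul_geomTorsion_pow p J) (p ^ J) f) y
  by_cases hJe : J ≤ e
  · obtain ⟨k, hk⟩ := Nat.exists_eq_add_of_le hJe
    rw [hk, pow_add, mul_comm, mul_smul, hkill, smul_zero]
  have hJ1 : 1 ≤ J := by omega
  -- the Weil pairing at level `p^J` and the inverse twist `u'`
  obtain ⟨eW, hμ, hadd₁, hadd₂, halt, hnondeg, hgal⟩ := WeierstrassCurve.exists_weilPairing_holds W (p ^ J)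
    (le_trans (Fact.out : p.Prime).two_le (Nat.le_self_pow (by omega) p))
    (by exact_mod_cast pow_ne_zero J (Fact.out : p.Prime).ne_zero)
  obtain ⟨u', hu', huu'⟩ := exists_inverse_twist (p := p) hu J
  -- `y = H¹(w) y'`
  set y' : galoisCohomology (W.twistedTorsionGaloisModule p κ J u' hu') 1 :=
    galoisCohomology.map (W.twistedWeilDualInv p κ J hu hu' huu' eW hμ hadd₁ hadd₂ hgal hnondeg) 1 y with hy'def
  have hyy' : galoisCohomology.map (W.twistedWeilDual p κ J hu hu' huu' eW hμ hadd₁ hadd₂ hgal) 1 y' = y :=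
    W.map_twistedWeilDual_map_inv p κ J hu hu' huu' eW hμ hadd₁ hadd₂ hgal hnondeg y
  -- `y' ∈ H¹_{𝓖^A(u')}`
  rw [SelmerStructure.mem_selmerGroup_iff] at hy
  have hy'G : y' ∈ (W.twistedSignedRelaxedSelmerStructure p S₀ κ J u' hu' A).selmerGroup := by
    rw [SelmerStructure.mem_selmerGroup_iff]
    intro v
    cases v with
    | inl w => rw [W.twistedSignedRelaxedSelmerStructure_inl]; exact AddSubgroup.mem_top _
    | inr v =>
      by_cases hv0 : v ∈ S₀
      · rw [W.twistedSignedRelaxedSelmerStructure_inr_of_mem p S₀ κ J u' hu' A hv0]; exact AddSubgroup.mem_top _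
      by_cases hpv : ((p : ℕ) : 𝓞 K) ∈ v.asIdeal
      · -- at `v ∣ p`: the `±`-duality
        rw [W.twistedSignedRelaxedSelmerStructure_inr_of_mem_asIdeal p S₀ κ J u' hu' A hv0 hpv]
        refine hdual J u' hu' huu' eW hμ hadd₁ hadd₂ hgal halt hnondeg inv hperf hvan hur v hpv _ ?_
        have hloc := hy (Sum.inr v)
        rw [LocalInvariants.dualSelmerStructure_apply, W.twistedSignedSelmerStructure_inr_of_mem_asIdeal p S₀ κ J u hu A hv0 hpv,
          ← hyy'] at hloc
        have hnat := galoisCohomology.res_map_one (v.adicCompletion K)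
          (W.twistedWeilDual p κ J hu hu' huu' eW hμ hadd₁ hadd₂ hgal) y'
        change galoisCohomology.res _ (v.adicCompletion K) 1 _ ∈ _ at hloc
        exact hnat ▸ hloc
      · -- at a finite place outside `S`: unramified duality + functoriality of unramified classes
        rw [W.twistedSignedRelaxedSelmerStructure_inr_of_not_mem p S₀ κ J u' hu' A hv0 hpv]
        have hvS : (Sum.inr v : Place K) ∉ twistedDescentPlaces (K := K) p S₀ :=
          (not_mem_twistedDescentPlaces_iff p S₀ v).2 ⟨hv0, hpv⟩
        have hloc := hy (Sum.inr v)
        rw [LocalInvariants.dualSelmerStructure_apply, W.twistedSignedSelmerStructure_inr_of_not_mem p S₀ κ J u hu A hv0 hpv,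
          (hur (W.twistedTorsionGaloisModule p κ J u hu) (W.pow_nsmul_geomTorsion_pow p J) v (hS J v hvS).1 (hS J v hvS).2).1]
          at hloc
        have hnat := galoisCohomology.res_map_one (v.adicCompletion K)
          (W.twistedWeilDualInv p κ J hu hu' huu' eW hμ hadd₁ hadd₂ hgal hnondeg) y
        change galoisCohomology.res _ (v.adicCompletion K) 1 y' ∈ _
        rw [hy'def]
        exact hnat ▸ Literature.NumberTheory.EllipticCurves.DiscreteGaloisModule.map_mem_unramifiedSubgroup _ hloc
  -- `c = twistedTorsionToH1 y' ∈ Sel♯^A_{S₀}` and `p^e y' = 0`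
  have hc := twistedTorsionToH1_mem_sharp_of_mem_selmerGroup_signedRelaxed W p S₀ κ u' hu' A hS₀ hy'G
  have hB : ∀ P : W.geomPrimaryTorsion p, (∀ h : κ.kerSubgroup, h • P = P) → p ^ 0 • P = 0 := fun P hP ↦ by
    rw [pow_zero, one_smul]; exact hfix P hP
  have hy'0 : p ^ (e + 0 + 0) • y' = 0 :=
    W.pow_smul_eq_zero_of_twistedTorsionToH1_mem p κ J hu' huu' hγ hB _ (fun s hs heig ↦ he s hs heig) y' hc
  rw [add_zero, add_zero] at hy'0
  rw [← hyy', ← map_nsmul, hy'0, map_zero]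

/-- **`hlev_eventual(u)` at `ℚ`, `p = 2` — repaired form** of `hlevEventual_two_of_plusDual_of_eigen` (`hdual` for non-degenerate Weil
data only; this is the statement w2's H-PLUSDUAL proves). [cite: GreenbergLNM1716, §4 Prop. 4.13 Remark (p. 122), proof of Prop. 4.14 (pp. 123–124)]
[cite: Kobayashi2003, Def. 1.1] -/
theorem hlevEventual_two_of_plusDualAlt_of_eigen (E : WeierstrassCurve ℚ) [E.IsElliptic] [E.IsGloballyMinimal]
    (hss : Rank1Residual.GoodSS E 2) (S₀ : Finset (HeightOneSpectrum (𝓞 ℚ))) (κ : ZpExtension ℚ 2)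
    {γ : Field.absoluteGaloisGroup ℚ} (hγ : κ.IsTopGenerator γ) (u : ℤ) (hu : (2 : ℤ) ∣ u - 1) (ε : ℤˣ)
    (hS2 : ∀ v ∈ S₀, ((2 : ℕ) : 𝓞 ℚ) ∉ v.asIdeal)
    (hS : ∀ v : HeightOneSpectrum (𝓞 ℚ), ¬ E.HasGoodReductionAt v → v ∈ S₀)
    (hdual : ∀ (J : ℕ) (u' : ℤ) (hu' : (2 : ℤ) ∣ u' - 1) (huu' : ((2 : ℤ) ^ J) ∣ u * u' - 1)
      (e : E.geomTorsion ((2 ^ J : ℕ) : ℤ) → E.geomTorsion ((2 ^ J : ℕ) : ℤ) → AlgebraicClosure ℚ)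
      (hμ : ∀ S T, e S T ^ (2 ^ J) = 1) (hadd₁ : ∀ S₁ S₂ T, e (S₁ + S₂) T = e S₁ T * e S₂ T)
      (hadd₂ : ∀ S T₁ T₂, e S (T₁ + T₂) = e S T₁ * e S T₂)
      (hgal : ∀ (σ : absoluteGaloisGroup ℚ) (S T : E.geomTorsion ((2 ^ J : ℕ) : ℤ)), σ • e S T = e (σ • S) (σ • T))
      (halt : ∀ T, e T T = 1) (hnondeg : ∀ T, (∀ S, e S T = 1) → T = 0)
      [Finite (E.geomTorsion ((2 ^ J : ℕ) : ℤ))]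
      (inv : LocalInvariants ℚ (2 ^ J)), inv.IsPerfect → inv.SumLocalTermEqZero → inv.UnramifiedOrthogonal →
      ∀ (v : HeightOneSpectrum (𝓞 ℚ)), ((2 : ℕ) : 𝓞 ℚ) ∈ v.asIdeal →
      ∀ y' : galoisCohomology ((E.twistedTorsionGaloisModule 2 κ J u' hu').restrictField (v.adicCompletion ℚ)) 1,
        galoisCohomology.map ((E.twistedWeilDual 2 κ J hu hu' huu' e hμ hadd₁ hadd₂ hgal).restrictField (v.adicCompletion ℚ)) 1 y' ∈
            inv.dualLocalCondition (E.twistedTorsionGaloisModule 2 κ J u hu) (Sum.inr v)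
              (E.twistedTorsionLocalKummer 2 κ J u hu (v.adicCompletion ℚ)
                (⨆ n : ℕ, signedLocalPoints κ (v.adicCompletion ℚ) E ε n)) →
        y' ∈ E.twistedTorsionLocalKummer 2 κ J u' hu' (v.adicCompletion ℚ) (⨆ n : ℕ, signedLocalPoints κ (v.adicCompletion ℚ) E ε n))
    (hfinE : ∃ e : ℕ, ∀ c ∈ unramifiedOutside κ.kerSubgroup ↥(E.geomPrimaryTorsion 2) 2 (↑S₀ : Set (HeightOneSpectrum (𝓞 ℚ))) ⊓
        ⨅ (v : HeightOneSpectrum (𝓞 ℚ)) (_ : ((2 : ℕ) : 𝓞 ℚ) ∈ v.asIdeal) (σ : Field.absoluteGaloisGroup ℚ),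
          (localKummerOverOfEmb E 2 κ.kerSubgroup (closureEmb (K := ℚ) (v.adicCompletion ℚ))
            (⨆ n : ℕ, signedLocalPoints κ (v.adicCompletion ℚ) E ε n)).comap (E.conjH1 2 κ.kerSubgroup σ),
      E.conjH1 2 κ.kerSubgroup γ c = u • c → 2 ^ e • c = 0)
    (J : ℕ) (t : ∀ v : HeightOneSpectrum (𝓞 ℚ),
      galoisCohomology ((E.twistedTorsionGaloisModule 2 κ J u hu).restrictField (v.adicCompletion ℚ)) 1) :
    ∃ (J' : ℕ) (hJ : J ≤ J') (x : galoisCohomology (E.twistedTorsionGaloisModule 2 κ J' u hu) 1),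
      E.twistedTorsionToH1 2 κ J' u hu x ∈
          unramifiedOutside κ.kerSubgroup ↥(E.geomPrimaryTorsion 2) 2 (↑S₀ : Set (HeightOneSpectrum (𝓞 ℚ))) ⊓
            ⨅ (v : HeightOneSpectrum (𝓞 ℚ)) (_ : ((2 : ℕ) : 𝓞 ℚ) ∈ v.asIdeal) (σ : Field.absoluteGaloisGroup ℚ),
              (localKummerOverOfEmb E 2 κ.kerSubgroup (closureEmb (K := ℚ) (v.adicCompletion ℚ))
                (⨆ n : ℕ, signedLocalPoints κ (v.adicCompletion ℚ) E ε n)).comap (E.conjH1 2 κ.kerSubgroup σ) ∧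
        ∀ v ∈ S₀, galoisCohomology.res (E.twistedTorsionGaloisModule 2 κ J' u hu) (v.adicCompletion ℚ) 1 x =
          galoisCohomology.map ((E.twistedTorsionIncl 2 κ hJ u hu).restrictField (v.adicCompletion ℚ)) 1 (t v) := by
  haveI hfin : ∀ J : ℕ, Finite (E.geomTorsion ((2 ^ J : ℕ) : ℤ)) := fun J ↦
    haveI : NeZero (2 ^ J) := ⟨pow_ne_zero _ two_ne_zero⟩
    finite_geomTorsion_of_neZero E (2 ^ J)
  -- the in-tree inputs
  have hPT : poitouTate_selmerStructure_duality ℚ := SchneiderFreeAdditiveX3.PoitouTateReduction.poitouTate_selmerStructure_duality_holds ℚ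
  have hdiv : E.zsmul_geomPoints_surjective := E.zsmul_geomPoints_surjective_holds
  have hgood : ∀ v : HeightOneSpectrum (𝓞 ℚ), v ∉ (↑S₀ : Set (HeightOneSpectrum (𝓞 ℚ))) → ((2 : ℕ) : 𝓞 ℚ) ∉ v.asIdeal →
      E.HasGoodReductionAt v := fun v hv _ ↦ by
    by_contra h; exact hv (Finset.mem_coe.2 (hS v h))
  have hSJ : ∀ (J : ℕ) (v : HeightOneSpectrum (𝓞 ℚ)), (Sum.inr v : Place ℚ) ∉ twistedDescentPlaces (K := ℚ) 2 S₀ →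
      ((2 ^ J : ℕ) : 𝓞 ℚ) ∉ v.asIdeal ∧ GaloisRep.IsUnramifiedAt v (E.twistedTorsionGaloisModule 2 κ J u hu) := by
    intro J v hv
    rw [not_mem_twistedDescentPlaces_iff] at hv
    exact E.natCast_pow_not_mem_and_isUnramifiedAt_twistedTorsionGaloisModule 2 κ J u hu hgood
      (fun h ↦ hv.1 (Finset.mem_coe.1 h)) hv.2
  have hbot := SignedTransportAtTwo.fixedPoints_kerSubgroup_eq_bot_of_goodSS E hss κ
  have hfix : ∀ P : E.geomPrimaryTorsion 2, (∀ h : κ.kerSubgroup, h • P = P) → P = 0 := by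
    intro P hP
    have hmem : P ∈ FixedPoints.addSubgroup κ.kerSubgroup (E.geomPrimaryTorsion 2) := by
      rw [FixedPoints.mem_addSubgroup]; exact hP
    rw [hbot] at hmem
    exact (AddSubgroup.mem_bot).mp hmem
  have hfixJ : ∀ (J : ℕ) (T : E.geomTorsion ((2 ^ J : ℕ) : ℤ)),
      (∀ h : absoluteGaloisGroup ℚ, h ∈ κ.kerSubgroup → h • T = T) → T = 0 := by
    intro J T hT
    have h0 := hfix (AddSubgroup.inclusion
      (Literature.Barriers.BirchSwinnertonDyer.geomTorsion_pow_le_geomPrimaryTorsion E 2 J) T) (fun h ↦ by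
        apply Subtype.ext
        rw [primaryComponent.coe_smul, AddSubgroup.coe_inclusion, Subgroup.smul_def, ← AddSubgroup.torsionBy.coe_smul,
          hT h h.2])
    have h1 := congrArg (fun b : E.geomPrimaryTorsion 2 ↦ (b : E.geomPoints)) h0
    simp only [AddSubgroup.coe_inclusion, ZeroMemClass.coe_zero] at h1
    exact Subtype.ext h1
  -- no twisted invariants in `Hom(ker π, μ)` (Weil pairing)
  have hinv : ∀ (j J : ℕ) (hjJ : j ≤ J) (m : TateDual ℚ (E.geomTorsion ((2 ^ J : ℕ) : ℤ)) (2 ^ J)),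
      (∀ (g : absoluteGaloisGroup ℚ) (R : E.geomTorsion ((2 ^ J : ℕ) : ℤ)), E.twistedTorsionMulPow 2 κ hjJ u hu R = 0 →
        ((E.twistedTorsionGaloisModule 2 κ J u hu).tateDual (2 ^ J) g m - m) R = 0) →
      ∀ R : E.geomTorsion ((2 ^ J : ℕ) : ℤ), E.twistedTorsionMulPow 2 κ hjJ u hu R = 0 → m R = 0 := by
    intro j J hjJ m hm R hR
    rcases Nat.eq_zero_or_pos J with hJ0 | hJpos
    · -- `J = 0`: `E[1] = 0`
      subst hJ0
      have hR0 : R = 0 := Subtype.ext (by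
        have h : ((2 ^ 0 : ℕ) : ℤ) • (R : E.geomPoints) = 0 := (Submodule.mem_torsionBy_iff _ _).mp R.2
        simp only [pow_zero, Nat.cast_one, one_smul] at h
        exact h)
      rw [hR0, map_zero]
    obtain ⟨eW, hμ, hadd₁, hadd₂, halt, hnondeg, hgal⟩ := WeierstrassCurve.exists_weilPairing_holds E (2 ^ J)
      (le_trans (le_refl 2) (Nat.le_self_pow (by omega) 2)) (by exact_mod_cast pow_ne_zero J two_ne_zero)
    obtain ⟨u', hu', huu'⟩ := exists_inverse_twist (p := 2) hu J
    exact E.forall_apply_eq_zero_of_tateDual_sub_apply_eq_zero 2 κ hjJ hu hu' huu' eW hμ hadd₁ hadd₂ hgal hnondeg hdiv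
      (hfixJ J) m hm R hR
  -- the uniform exponent (D5) and the tower (D4c)
  have hexp := uniformExponent_of_plusDualAlt_of_eigen E 2 S₀ κ u hu
    (fun v ↦ ⨆ n : ℕ, signedLocalPoints κ (v.adicCompletion ℚ) E ε n)
    hγ hS2 hSJ hfix (fun J u' hu' huu' e hμ hadd₁ hadd₂ hgal halt hnondeg ↦ hdual J u' hu' huu' e hμ hadd₁ hadd₂ hgal halt hnondeg) hfinE
  have htower := E.tower_of_uniform_exponent 2 κ u hu hdiv
    (fun J ↦ E.twistedSignedSelmerStructure 2 S₀ κ J u hu (fun v ↦ ⨆ n : ℕ, signedLocalPoints κ (v.adicCompletion ℚ) E ε n))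
    hinv hexp
  exact hlevEventual_of_poitouTate_of_tower' E 2 S₀ κ u hu ε hPT hS2 hSJ htower J t

end Summit.BirchSwinnertonDyer.BirchSwinnertonDyer.Theorems.SignedEC.TwistedPT

end
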